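import Literature.NumberTheory.Sieve.HeathBrownCubicLatticeGeometry
import Literature.NumberTheory.Sieve.LargeSieveInequality
import HarnessLib

/-!
# Heath-Brown's Lemma 3.10, §13 p. 78: the divisibility `dD ∣ v` by additive characters

Support for the proof of **Lemma 3.10** of D. R. Heath-Brown, *Primes represented by `x³ + 2y³`*,
Acta Math. 186 (2001), §13 p. 78:

> "We have already remarked in §11 that the condition `D | v` may be rewritten as `β̂₂ ≡ Λβ̂₁ (mod D)`
> for some integer `Λ`, which is necessarily coprime to `D`. We apply this remark with `D` replaced by
> `dD`. If we introduce the exponential sum `S(a) = S(a, C) = ∑_{β̂ ∈ C} exp{2πi a·β̂} G_β` (13.1), where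
> `G_β = F'_β`, we find that
> `∑_{β̂ᵢ ∈ Cᵢ, Dd ∣ v} F'_{β₁}F'_{β₂} = (Dd)⁻³ ∑_{Λ (mod dD), (Λ,dD)=1} ∑_{a (mod dD)} S((dD)⁻¹Λa; C₁) S̄((dD)⁻¹a; C₂)`.
> … Cauchy's inequality then yields `… ≤ ∑ (Dd)⁻² ∑_{a (mod dD)} |S((dD)⁻¹a; C)|²` for `C = C₁` or `C₂`.
> Here we have used the observation that `∑_a |S((dD)⁻¹Λa; C)|² = ∑_a |S((dD)⁻¹a; C)|²` whenever `Λ` is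
> coprime to `dD`."

All statements here are PROVED:

* `Sfrac w C e a = ∑_{v ∈ C} w(v) e(a·v/e)` and `Tsum w C e = ∑_{a (mod e)} |Sfrac|²` (over `a ∈ [0,e)³`);
* `sum_range_e_eq` (orthogonality `∑_{a<e} e(am/e) = e·[e ∣ m]`) and its three-dimensional form
  `sum_resVecs_e_eq`;
* `dvdVec_cross3_iff_exists_lam` (`e ∣ β̂₁ ∧ β̂₂ ⟺ β̂₂ ≡ Λβ̂₁` for primitive `β̂₁`, with `Λ` unique mod `e`
  and coprime to `e` when `β̂₂` is primitive);
* `Tsum_smul_unit` (`∑_a |S(Λa/e)|² = ∑_a |S(a/e)|²` for `Λ` coprime to `e`);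
* **`abs_sum_dvd_cross3_le`**: `|∑_{β̂ᵢ ∈ Cᵢ, e ∣ β̂₁∧β̂₂} w₁(β̂₁)w₂(β̂₂)| ≤ (T₁(e) + T₂(e))/(2e²)` for weights
  supported on primitive vectors.

## References

* D. R. Heath-Brown, *Primes represented by `x³ + 2y³`*, Acta Math. 186 (2001), §13 p. 78.
  [cite: HeathBrownActa2001, §13 p. 78]

## Mathlib / tree search

Tree: `LargeSieveInequality` (`e`, `e_add`, `e_int`, `e_nat_mul`, `conj_e`, `norm_e`), `HeathBrownCubicLemma111`
(`cross3`, `DvdVec`, `IsPrimitiveVec`, `exists_dot_eq_one`, `modEq_smul_of_dvd_cross3`),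
`HeathBrownCubicLatticeGeometry` (`dot3`). Mathlib: `geom_sum_eq`, `Complex.exp_eq_one_iff`,
`inner_mul_le_norm_mul_norm` / `Finset.sum_mul_sq_le_sq_mul_sq`.
-/

noncomputable section

open Finset Complex

open scoped ComplexConjugate

namespace Literature.NumberTheory.Sieve.CubicSieve

open LargeSieve

/-! ### Exponential sums over a finite set of lattice vectors -/

/-- The residue vectors `a ∈ [0, e)³`. [folklore] -/
def resVecs (e : ℕ) : Finset (ℤ × ℤ × ℤ) := Ico (0 : ℤ) e ×ˢ (Ico (0 : ℤ) e ×ˢ Ico (0 : ℤ) e)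

/-- **`S(a/e; C) = ∑_{β̂ ∈ C} w(β̂) e(a·β̂/e)`** ((13.1) with `G_β = w(β̂)`). [cite: HeathBrownActa2001, §13 (13.1)] -/
def Sfrac (w : ℤ × ℤ × ℤ → ℝ) (C : Finset (ℤ × ℤ × ℤ)) (e : ℕ) (a : ℤ × ℤ × ℤ) : ℂ :=
  ∑ v ∈ C, (w v : ℂ) * LargeSieve.e ((dot3 a v : ℤ) / (e : ℝ))

/-- **`T(e) = ∑_{a (mod e)} |S(a/e; C)|²`**. [cite: HeathBrownActa2001, §13 p. 78] -/
def Tsum (w : ℤ × ℤ × ℤ → ℝ) (C : Finset (ℤ × ℤ × ℤ)) (e : ℕ) : ℝ :=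
  ∑ a ∈ resVecs e, ‖Sfrac w C e a‖ ^ 2

/-- `Tsum ≥ 0`. [folklore] -/
theorem Tsum_nonneg (w : ℤ × ℤ × ℤ → ℝ) (C : Finset (ℤ × ℤ × ℤ)) (e : ℕ) : 0 ≤ Tsum w C e :=
  sum_nonneg fun _ _ => by positivity

/-! ### Orthogonality -/

/-- `e(m/e) = 1` iff `e ∣ m` (`e ≥ 1`). [folklore] -/
theorem e_div_eq_one_iff {e : ℕ} (he : 0 < e) (m : ℤ) : LargeSieve.e ((m : ℝ) / e) = 1 ↔ (e : ℤ) ∣ m := by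
  have heR : (e : ℝ) ≠ 0 := by exact_mod_cast he.ne'
  constructor
  · intro h
    rw [e_eq_exp, Complex.exp_eq_one_iff] at h
    obtain ⟨n, hn⟩ := h
    have h2 : ((m : ℝ) / e : ℂ) = (n : ℂ) := by
      have hI : (2 * ↑Real.pi * I : ℂ) ≠ 0 := by
        simp [Real.pi_ne_zero, Complex.I_ne_zero]
      have : I * ((2 * Real.pi * ((m : ℝ) / e) : ℝ) : ℂ) = ((m : ℝ) / e : ℝ) * (2 * Real.pi * I) := by
        push_cast; ring
      rw [this] at hn
      have := mul_right_cancel₀ hI hn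
      exact_mod_cast this
    have h3 : (m : ℝ) / e = n := by exact_mod_cast h2
    rw [div_eq_iff heR] at h3
    refine ⟨n, ?_⟩
    have : (m : ℝ) = ((n * e : ℤ) : ℝ) := by rw [h3]; push_cast; ring
    have := Int.cast_injective this
    rw [this]; ring
  · rintro ⟨k, hk⟩
    rw [hk]
    have : (((e : ℤ) * k : ℤ) : ℝ) / e = (k : ℝ) := by push_cast; field_simp
    rw [this]
    exact e_int k

/-- **Orthogonality**: `∑_{a=0}^{e−1} e(am/e) = e` if `e ∣ m`, and `0` otherwise. [folklore] -/
theorem sum_range_e_eq {e : ℕ} (he : 0 < e) (m : ℤ) :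
    ∑ a ∈ Ico (0 : ℤ) e, LargeSieve.e (((a * m : ℤ) : ℝ) / e) = if (e : ℤ) ∣ m then (e : ℂ) else 0 := by
  have heR : (e : ℝ) ≠ 0 := by exact_mod_cast he.ne'
  -- reindex by `a : ℕ`
  have hre : ∑ a ∈ Ico (0 : ℤ) e, LargeSieve.e (((a * m : ℤ) : ℝ) / e) =
      ∑ a ∈ range e, LargeSieve.e ((m : ℝ) / e) ^ a := by
    rw [range_eq_Ico]
    have : Ico (0 : ℤ) e = (Ico 0 e).image (fun a : ℕ => (a : ℤ)) := by
      ext x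
      simp only [mem_Ico, mem_image]
      constructor
      · rintro ⟨h0, h1⟩
        refine ⟨x.toNat, ⟨by omega, by omega⟩, by omega⟩
      · rintro ⟨a, ⟨-, ha⟩, rfl⟩; exact ⟨by omega, by omega⟩
    rw [this, sum_image (fun a _ b _ h => by exact_mod_cast h)]
    refine sum_congr rfl fun a _ => ?_
    rw [← e_nat_mul]; congr 1; push_cast; ring
  rw [hre]
  by_cases hdvd : (e : ℤ) ∣ m
  · rw [if_pos hdvd, (e_div_eq_one_iff he m).mpr hdvd]
    simp
  · rw [if_neg hdvd]
    have hne : LargeSieve.e ((m : ℝ) / e) ≠ 1 := fun h => hdvd ((e_div_eq_one_iff he m).mp h)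
    rw [geom_sum_eq hne]
    have : LargeSieve.e ((m : ℝ) / e) ^ e = 1 := by
      rw [← e_nat_mul, show ((e : ℕ) : ℝ) * ((m : ℝ) / e) = (m : ℤ) by field_simp]
      exact e_int m
    rw [this, sub_self, zero_div]

/-- Membership in `resVecs`. [folklore] -/
theorem mem_resVecs {e : ℕ} {a : ℤ × ℤ × ℤ} :
    a ∈ resVecs e ↔ (0 ≤ a.1 ∧ a.1 < e) ∧ (0 ≤ a.2.1 ∧ a.2.1 < e) ∧ (0 ≤ a.2.2 ∧ a.2.2 < e) := by
  simp only [resVecs, mem_product, mem_Ico]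

/-- `#resVecs e = e³`. [folklore] -/
theorem card_resVecs (e : ℕ) : #(resVecs e) = e ^ 3 := by
  simp only [resVecs, card_product, Int.card_Ico, sub_zero, Int.toNat_natCast]; ring

open scoped Classical in
/-- **Three-dimensional orthogonality**: `∑_{a ∈ [0,e)³} e(a·w/e) = e³ [e ∣ w]`. [folklore] -/
theorem sum_resVecs_e_eq {e : ℕ} (he : 0 < e) (w : ℤ × ℤ × ℤ) :
    ∑ a ∈ resVecs e, LargeSieve.e ((dot3 a w : ℤ) / (e : ℝ)) =
      if DvdVec (e : ℤ) w then ((e : ℂ)) ^ 3 else 0 := by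
  classical
  have hsplit : ∀ a : ℤ × ℤ × ℤ, LargeSieve.e ((dot3 a w : ℤ) / (e : ℝ)) =
      LargeSieve.e (((a.1 * w.1 : ℤ) : ℝ) / e) * (LargeSieve.e (((a.2.1 * w.2.1 : ℤ) : ℝ) / e) *
        LargeSieve.e (((a.2.2 * w.2.2 : ℤ) : ℝ) / e)) := by
    intro a
    rw [← e_add, ← e_add]; congr 1; simp only [dot3]; push_cast; ring
  simp_rw [hsplit]
  rw [resVecs, sum_product]
  dsimp only
  simp_rw [← mul_sum]
  rw [← sum_mul, sum_product]
  dsimp only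
  simp_rw [← mul_sum]
  rw [← sum_mul, sum_range_e_eq he, sum_range_e_eq he, sum_range_e_eq he]
  by_cases h : DvdVec (e : ℤ) w
  · rw [if_pos h, if_pos h.1, if_pos h.2.1, if_pos h.2.2]; ring
  · rw [if_neg h]
    simp only [DvdVec, not_and_or] at h
    rcases h with h | h | h
    · rw [if_neg h]; ring
    · rw [if_neg h]; ring
    · rw [if_neg h]; ring

/-! ### `e ∣ β̂₁ ∧ β̂₂` as a congruence `β̂₂ ≡ Λβ̂₁ (mod e)` -/

/-- `d ∣ w ⟹ d ∣ b ∧ w` (componentwise). [folklore] -/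
theorem dvdVec_cross3_of_dvdVec {d : ℤ} (b : ℤ × ℤ × ℤ) {w : ℤ × ℤ × ℤ} (h : DvdVec d w) :
    DvdVec d (cross3 b w) := by
  obtain ⟨h1, h2, h3⟩ := h
  simp only [cross3]
  exact ⟨dvd_sub (dvd_mul_of_dvd_right h3 _) (dvd_mul_of_dvd_right h2 _),
    dvd_sub (dvd_mul_of_dvd_right h1 _) (dvd_mul_of_dvd_right h3 _),
    dvd_sub (dvd_mul_of_dvd_right h2 _) (dvd_mul_of_dvd_right h1 _)⟩

/-- `DvdVec` is additive and homogeneous. [folklore] -/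
theorem dvdVec_add {d : ℤ} {v w : ℤ × ℤ × ℤ} (hv : DvdVec d v) (hw : DvdVec d w) : DvdVec d (v + w) :=
  ⟨by simpa using dvd_add hv.1 hw.1, by simpa using dvd_add hv.2.1 hw.2.1, by simpa using dvd_add hv.2.2 hw.2.2⟩

/-- `DvdVec d (μ • v)` when `d ∣ μ`. [folklore] -/
theorem dvdVec_smul_of_dvd {d μ : ℤ} (h : d ∣ μ) (v : ℤ × ℤ × ℤ) : DvdVec d (μ • v) :=
  ⟨by simpa using dvd_mul_of_dvd_left h v.1, by simpa using dvd_mul_of_dvd_left h v.2.1,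
    by simpa using dvd_mul_of_dvd_left h v.2.2⟩

/-- `DvdVec d (μ • v)` when `DvdVec d v`. [folklore] -/
theorem dvdVec_smul {d : ℤ} (μ : ℤ) {v : ℤ × ℤ × ℤ} (h : DvdVec d v) : DvdVec d (μ • v) :=
  ⟨by simpa using dvd_mul_of_dvd_right h.1 μ, by simpa using dvd_mul_of_dvd_right h.2.1 μ,
    by simpa using dvd_mul_of_dvd_right h.2.2 μ⟩

/-- `DvdVec d (-v) ↔ DvdVec d v` (one direction). [folklore] -/
theorem dvdVec_neg {d : ℤ} {v : ℤ × ℤ × ℤ} (h : DvdVec d v) : DvdVec d (-v) := by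
  have := dvdVec_smul (-1) h; simpa using this

/-- For primitive `β̂₁`: `e ∣ β̂₁ ∧ β̂₂` iff `β̂₂ ≡ Λβ̂₁ (mod e)` for some `Λ ∈ [0, e)` ("the condition `D | v`
may be rewritten as `β̂₂ ≡ Λβ̂₁ (mod D)`"). [cite: HeathBrownActa2001, §11 p. 71] -/
theorem dvdVec_cross3_iff_exists_lam {e : ℕ} (he : 0 < e) {b₁ : ℤ × ℤ × ℤ} (hb₁ : IsPrimitiveVec b₁)
    (b₂ : ℤ × ℤ × ℤ) :
    DvdVec (e : ℤ) (cross3 b₁ b₂) ↔ ∃ lam ∈ Ico (0 : ℤ) e, DvdVec (e : ℤ) (b₂ - lam • b₁) := by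
  have he0 : (e : ℤ) ≠ 0 := by exact_mod_cast he.ne'
  constructor
  · intro h
    obtain ⟨c, hc⟩ := exists_dot_eq_one hb₁
    have hmod := modEq_smul_of_dvd_cross3 hc h
    set μ : ℤ := c.1 * b₂.1 + c.2.1 * b₂.2.1 + c.2.2 * b₂.2.2 with hμ
    refine ⟨μ % e, ?_, ?_⟩
    · rw [mem_Ico]; exact ⟨Int.emod_nonneg _ he0, Int.emod_lt_of_pos _ (by exact_mod_cast he)⟩
    · have hdiff : (e : ℤ) ∣ μ - μ % e := ⟨μ / e, by rw [Int.emod_def]; ring⟩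
      have e1 : b₂ - (μ % (e : ℤ)) • b₁ = (b₂ - μ • b₁) + (μ - μ % e) • b₁ := by
        rw [sub_smul]; abel
      rw [e1]
      exact dvdVec_add hmod (dvdVec_smul_of_dvd hdiff b₁)
  · rintro ⟨lam, -, hlam⟩
    have e1 : cross3 b₁ b₂ = cross3 b₁ (b₂ - lam • b₁) := by
      simp only [cross3, Prod.fst_sub, Prod.snd_sub, Prod.smul_fst, Prod.smul_snd, smul_eq_mul]; ring_nf
    rw [e1]; exact dvdVec_cross3_of_dvdVec b₁ hlam

/-- Uniqueness of `Λ` modulo `e` (`β̂₁` primitive). [cite: HeathBrownActa2001, §11 p. 71] -/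
theorem dvd_sub_of_lam {e : ℕ} {b₁ : ℤ × ℤ × ℤ} (hb₁ : IsPrimitiveVec b₁) {b₂ : ℤ × ℤ × ℤ} {lam lam' : ℤ}
    (h : DvdVec (e : ℤ) (b₂ - lam • b₁)) (h' : DvdVec (e : ℤ) (b₂ - lam' • b₁)) : (e : ℤ) ∣ lam' - lam := by
  obtain ⟨c, hc⟩ := exists_dot_eq_one hb₁
  have hd : DvdVec (e : ℤ) ((lam - lam') • b₁) := by
    have e1 : (lam - lam') • b₁ = (b₂ - lam' • b₁) + -(b₂ - lam • b₁) := by rw [sub_smul]; abel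
    rw [e1]; exact dvdVec_add h' (dvdVec_neg h)
  obtain ⟨h1, h2, h3⟩ := hd
  simp only [Prod.smul_fst, Prod.smul_snd, smul_eq_mul] at h1 h2 h3
  have : (lam - lam') = c.1 * ((lam - lam') * b₁.1) + c.2.1 * ((lam - lam') * b₁.2.1) + c.2.2 * ((lam - lam') * b₁.2.2) := by
    have := hc; linear_combination -(lam - lam') * this
  have hdvd : (e : ℤ) ∣ lam - lam' := by
    rw [this]
    exact dvd_add (dvd_add (dvd_mul_of_dvd_right h1 _) (dvd_mul_of_dvd_right h2 _)) (dvd_mul_of_dvd_right h3 _)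
  have := dvd_neg.mpr hdvd; simpa using this

/-- `Λ` is coprime to `e` when `β̂₂` is primitive ("which is necessarily coprime to `D`").
[cite: HeathBrownActa2001, §13 p. 78] -/
theorem gcd_lam_eq_one {e : ℕ} {b₁ b₂ : ℤ × ℤ × ℤ} (hb₂ : IsPrimitiveVec b₂) {lam : ℤ}
    (h : DvdVec (e : ℤ) (b₂ - lam • b₁)) : Int.gcd lam e = 1 := by
  set g : ℕ := Int.gcd lam e with hg
  have hgl : (g : ℤ) ∣ lam := Int.gcd_dvd_left _ _
  have hge : (g : ℤ) ∣ (e : ℤ) := Int.gcd_dvd_right _ _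
  have hb : DvdVec (g : ℤ) b₂ := by
    have e1 : b₂ = (b₂ - lam • b₁) + lam • b₁ := by abel
    obtain ⟨h1, h2, h3⟩ := h
    rw [e1]
    exact dvdVec_add ⟨hge.trans h1, hge.trans h2, hge.trans h3⟩ (dvdVec_smul_of_dvd hgl b₁)
  have hu : IsUnit (g : ℤ) := hb₂ _ hb.1 hb.2.1 hb.2.2
  have := Int.isUnit_iff_natAbs_eq.mp hu
  simpa using this

open scoped Classical in
/-- The residues coprime to `e` in `[0, e)`. [folklore] -/
def unitRes (e : ℕ) : Finset ℤ := (Ico (0 : ℤ) e).filter (fun lam => Int.gcd lam e = 1)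

/-- `#unitRes e ≤ e`. [folklore] -/
theorem card_unitRes_le (e : ℕ) : #(unitRes e) ≤ e := by
  classical
  calc #(unitRes e) ≤ #(Ico (0 : ℤ) e) := card_filter_le _ _
    _ = e := by simp

open scoped Classical in
/-- **The indicator identity**: for primitive `β̂₁, β̂₂`,
`[e ∣ β̂₁ ∧ β̂₂] = ∑_{Λ ∈ unitRes e} [β̂₂ ≡ Λβ̂₁ (mod e)]`. [cite: HeathBrownActa2001, §13 p. 78] -/
theorem indicator_dvd_cross3_eq {e : ℕ} (he : 0 < e) {b₁ b₂ : ℤ × ℤ × ℤ} (hb₁ : IsPrimitiveVec b₁)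
    (hb₂ : IsPrimitiveVec b₂) :
    (if DvdVec (e : ℤ) (cross3 b₁ b₂) then (1 : ℝ) else 0) =
      ∑ lam ∈ unitRes e, if DvdVec (e : ℤ) (b₂ - lam • b₁) then (1 : ℝ) else 0 := by
  classical
  rw [← sum_filter, sum_const, nsmul_eq_mul, mul_one]
  by_cases h : DvdVec (e : ℤ) (cross3 b₁ b₂)
  · rw [if_pos h]
    obtain ⟨lam₀, hmem, hlam₀⟩ := (dvdVec_cross3_iff_exists_lam he hb₁ b₂).mp h
    have hset : (unitRes e).filter (fun lam => DvdVec (e : ℤ) (b₂ - lam • b₁)) = {lam₀} := by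
      ext lam
      rw [mem_filter, unitRes, mem_filter, mem_singleton]
      constructor
      · rintro ⟨⟨hl, -⟩, hd⟩
        have hdvd := dvd_sub_of_lam hb₁ hlam₀ hd
        rw [mem_Ico] at hl hmem
        have : |lam - lam₀| < e := by rw [abs_lt]; constructor <;> omega
        have h0 := Int.eq_zero_of_abs_lt_dvd hdvd this
        omega
      · rintro rfl
        exact ⟨⟨hmem, gcd_lam_eq_one hb₂ hlam₀⟩, hlam₀⟩
    rw [hset, card_singleton, Nat.cast_one]
  · rw [if_neg h]
    have hset : (unitRes e).filter (fun lam => DvdVec (e : ℤ) (b₂ - lam • b₁)) = ∅ := by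
      rw [filter_eq_empty_iff]
      intro lam hl hd
      rw [unitRes, mem_filter] at hl
      exact h ((dvdVec_cross3_iff_exists_lam he hb₁ b₂).mpr ⟨lam, hl.1, hd⟩)
    rw [hset, card_empty, Nat.cast_zero]

/-! ### Periodicity and the unit substitution `a ↦ Λa` -/

/-- `S(a/e)` depends only on `a (mod e)`. [folklore] -/
theorem Sfrac_congr {e : ℕ} (he : 0 < e) (w : ℤ × ℤ × ℤ → ℝ) (C : Finset (ℤ × ℤ × ℤ)) {a a' : ℤ × ℤ × ℤ}
    (h : DvdVec (e : ℤ) (a - a')) : Sfrac w C e a = Sfrac w C e a' := by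
  have heR : (e : ℝ) ≠ 0 := by exact_mod_cast he.ne'
  refine sum_congr rfl fun v _ => ?_
  congr 1
  obtain ⟨⟨k1, hk1⟩, ⟨k2, hk2⟩, ⟨k3, hk3⟩⟩ := h
  simp only [Prod.fst_sub, Prod.snd_sub] at hk1 hk2 hk3
  have : dot3 a v = dot3 a' v + (e : ℤ) * (k1 * v.1 + k2 * v.2.1 + k3 * v.2.2) := by
    simp only [dot3]; linear_combination v.1 * hk1 + v.2.1 * hk2 + v.2.2 * hk3
  rw [this, Int.cast_add, add_div]
  have : (((e : ℤ) * (k1 * v.1 + k2 * v.2.1 + k3 * v.2.2) : ℤ) : ℝ) / e = ((k1 * v.1 + k2 * v.2.1 + k3 * v.2.2 : ℤ) : ℝ) := by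
    push_cast; field_simp
  rw [this, e_add_int]

/-- Reduction of a vector modulo `e`. [folklore] -/
def redVec (e : ℕ) (a : ℤ × ℤ × ℤ) : ℤ × ℤ × ℤ := (a.1 % e, a.2.1 % e, a.2.2 % e)

/-- `redVec e a ∈ resVecs e` (`e ≥ 1`). [folklore] -/
theorem redVec_mem {e : ℕ} (he : 0 < e) (a : ℤ × ℤ × ℤ) : redVec e a ∈ resVecs e := by
  have he0 : (e : ℤ) ≠ 0 := by exact_mod_cast he.ne'
  have heZ : (0 : ℤ) < e := by exact_mod_cast he
  rw [mem_resVecs, redVec]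
  exact ⟨⟨Int.emod_nonneg _ he0, Int.emod_lt_of_pos _ heZ⟩, ⟨Int.emod_nonneg _ he0, Int.emod_lt_of_pos _ heZ⟩,
    ⟨Int.emod_nonneg _ he0, Int.emod_lt_of_pos _ heZ⟩⟩

/-- `e ∣ a - redVec e a`. [folklore] -/
theorem dvdVec_sub_redVec (e : ℕ) (a : ℤ × ℤ × ℤ) : DvdVec (e : ℤ) (a - redVec e a) := by
  refine ⟨⟨a.1 / e, ?_⟩, ⟨a.2.1 / e, ?_⟩, ⟨a.2.2 / e, ?_⟩⟩ <;>
    simp only [redVec, Prod.fst_sub, Prod.snd_sub] <;> rw [Int.emod_def] <;> ring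

/-- An element of `resVecs e` congruent to `0` is `0`-distance: two elements of `resVecs e` congruent
mod `e` are equal. [folklore] -/
theorem eq_of_dvdVec_sub {e : ℕ} {a a' : ℤ × ℤ × ℤ} (ha : a ∈ resVecs e) (ha' : a' ∈ resVecs e)
    (h : DvdVec (e : ℤ) (a - a')) : a = a' := by
  rw [mem_resVecs] at ha ha'
  obtain ⟨h1, h2, h3⟩ := h
  simp only [Prod.fst_sub, Prod.snd_sub] at h1 h2 h3
  have e1 : a.1 = a'.1 := by
    have : |a.1 - a'.1| < e := by rw [abs_lt]; constructor <;> omega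
    have := Int.eq_zero_of_abs_lt_dvd h1 this; omega
  have e2 : a.2.1 = a'.2.1 := by
    have : |a.2.1 - a'.2.1| < e := by rw [abs_lt]; constructor <;> omega
    have := Int.eq_zero_of_abs_lt_dvd h2 this; omega
  have e3 : a.2.2 = a'.2.2 := by
    have : |a.2.2 - a'.2.2| < e := by rw [abs_lt]; constructor <;> omega
    have := Int.eq_zero_of_abs_lt_dvd h3 this; omega
  exact Prod.ext e1 (Prod.ext e2 e3)

/-- **"`∑_a |S(Λa/e)|² = ∑_a |S(a/e)|²` whenever `Λ` is coprime to `e`"**. [cite: HeathBrownActa2001, §13 p. 78] -/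
theorem Tsum_smul_unit {e : ℕ} (he : 0 < e) (w : ℤ × ℤ × ℤ → ℝ) (C : Finset (ℤ × ℤ × ℤ)) {μ : ℤ}
    (hμ : Int.gcd μ e = 1) :
    ∑ a ∈ resVecs e, ‖Sfrac w C e (μ • a)‖ ^ 2 = Tsum w C e := by
  classical
  -- replace `μ • a` by its reduction, then reindex
  have hred : ∀ a, Sfrac w C e (μ • a) = Sfrac w C e (redVec e (μ • a)) :=
    fun a => Sfrac_congr he w C (dvdVec_sub_redVec e _)
  simp_rw [hred]
  have hinj : Set.InjOn (fun a => redVec e (μ • a)) (resVecs e : Set (ℤ × ℤ × ℤ)) := by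
    intro a ha a' ha' h
    simp only at h
    have hd : DvdVec (e : ℤ) (μ • a - μ • a') := by
      have h1 := dvdVec_sub_redVec e (μ • a)
      have h2 := dvdVec_sub_redVec e (μ • a')
      rw [h] at h1
      have e1 : μ • a - μ • a' = (μ • a - redVec e (μ • a')) + -(μ • a' - redVec e (μ • a')) := by abel
      rw [e1]; exact dvdVec_add h1 (dvdVec_neg h2)
    rw [← smul_sub] at hd
    have hcop : IsCoprime (e : ℤ) μ := by
      rw [Int.isCoprime_iff_gcd_eq_one, Int.gcd_comm]; exact hμ
    obtain ⟨d1, d2, d3⟩ := hd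
    simp only [Prod.smul_fst, Prod.smul_snd, smul_eq_mul] at d1 d2 d3
    exact eq_of_dvdVec_sub ha ha' ⟨hcop.dvd_of_dvd_mul_left d1, hcop.dvd_of_dvd_mul_left d2,
      hcop.dvd_of_dvd_mul_left d3⟩
  have himage : (resVecs e).image (fun a => redVec e (μ • a)) = resVecs e := by
    apply eq_of_subset_of_card_le
    · intro x hx
      obtain ⟨a, -, rfl⟩ := mem_image.mp hx
      exact redVec_mem he _
    · rw [card_image_of_injOn hinj]
  rw [Tsum, ← sum_image (f := fun a => ‖Sfrac w C e a‖ ^ 2) hinj, himage]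

/-! ### The main inequality -/

open scoped Classical in
/-- **Heath-Brown's character-sum step with Cauchy's inequality**: for real weights `w₁, w₂` supported
on primitive vectors and `e ≥ 1`,
`|∑_{β̂₁ ∈ C₁, β̂₂ ∈ C₂, e ∣ β̂₁∧β̂₂} w₁(β̂₁) w₂(β̂₂)| ≤ (T₁(e) + T₂(e)) / (2e²)`,
`Tᵢ(e) = ∑_{a (mod e)} |S(a/e; Cᵢ)|²`. [cite: HeathBrownActa2001, §13 p. 78] -/
theorem abs_sum_dvd_cross3_le {e : ℕ} (he : 0 < e) (w₁ w₂ : ℤ × ℤ × ℤ → ℝ)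
    (hw₁ : ∀ v, w₁ v ≠ 0 → IsPrimitiveVec v) (hw₂ : ∀ v, w₂ v ≠ 0 → IsPrimitiveVec v)
    (C₁ C₂ : Finset (ℤ × ℤ × ℤ)) :
    |∑ b₁ ∈ C₁, ∑ b₂ ∈ C₂, (if DvdVec (e : ℤ) (cross3 b₁ b₂) then w₁ b₁ * w₂ b₂ else 0)| ≤
      (Tsum w₁ C₁ e + Tsum w₂ C₂ e) / (2 * (e : ℝ) ^ 2) := by
  classical
  have heR : (0 : ℝ) < e := by exact_mod_cast he
  have heC : ((e : ℂ)) ^ 3 ≠ 0 := by exact_mod_cast (pow_ne_zero 3 he.ne')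
  -- Step 1: insert the `Λ`-identity
  have step1 : ∑ b₁ ∈ C₁, ∑ b₂ ∈ C₂, (if DvdVec (e : ℤ) (cross3 b₁ b₂) then w₁ b₁ * w₂ b₂ else 0) =
      ∑ lam ∈ unitRes e, ∑ b₁ ∈ C₁, ∑ b₂ ∈ C₂,
        (if DvdVec (e : ℤ) (b₂ - lam • b₁) then w₁ b₁ * w₂ b₂ else 0) := by
    have hre : ∑ lam ∈ unitRes e, ∑ b₁ ∈ C₁, ∑ b₂ ∈ C₂,
        (if DvdVec (e : ℤ) (b₂ - lam • b₁) then w₁ b₁ * w₂ b₂ else 0) =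
        ∑ b₁ ∈ C₁, ∑ b₂ ∈ C₂, ∑ lam ∈ unitRes e,
          (if DvdVec (e : ℤ) (b₂ - lam • b₁) then w₁ b₁ * w₂ b₂ else 0) := by
      calc ∑ lam ∈ unitRes e, ∑ b₁ ∈ C₁, ∑ b₂ ∈ C₂, (if DvdVec (e : ℤ) (b₂ - lam • b₁) then w₁ b₁ * w₂ b₂ else 0)
          = ∑ b₁ ∈ C₁, ∑ lam ∈ unitRes e, ∑ b₂ ∈ C₂, (if DvdVec (e : ℤ) (b₂ - lam • b₁) then w₁ b₁ * w₂ b₂ else 0) :=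
            Finset.sum_comm
        _ = _ := sum_congr rfl fun b₁ _ => Finset.sum_comm
    rw [hre]
    refine sum_congr rfl fun b₁ _ => ?_
    refine sum_congr rfl fun b₂ _ => ?_
    by_cases hz : w₁ b₁ * w₂ b₂ = 0
    · rw [hz]; simp
    · have hp1 : IsPrimitiveVec b₁ := hw₁ _ (left_ne_zero_of_mul hz)
      have hp2 : IsPrimitiveVec b₂ := hw₂ _ (right_ne_zero_of_mul hz)
      have hid := indicator_dvd_cross3_eq he hp1 hp2
      have e1 : (if DvdVec (e : ℤ) (cross3 b₁ b₂) then w₁ b₁ * w₂ b₂ else 0) =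
          (if DvdVec (e : ℤ) (cross3 b₁ b₂) then (1 : ℝ) else 0) * (w₁ b₁ * w₂ b₂) := by
        split_ifs <;> simp
      rw [e1, hid, sum_mul]
      refine sum_congr rfl fun lam _ => ?_
      split_ifs <;> simp
  -- Step 2: for each `Λ`, orthogonality and Cauchy–Schwarz
  have step2 : ∀ lam ∈ unitRes e,
      |∑ b₁ ∈ C₁, ∑ b₂ ∈ C₂, (if DvdVec (e : ℤ) (b₂ - lam • b₁) then w₁ b₁ * w₂ b₂ else 0)| ≤
        (Tsum w₁ C₁ e + Tsum w₂ C₂ e) / (2 * (e : ℝ) ^ 3) := by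
    intro lam hlam
    rw [unitRes, mem_filter] at hlam
    -- complex form
    set Z : ℂ := ∑ a ∈ resVecs e, Sfrac w₂ C₂ e a * Sfrac w₁ C₁ e ((-lam) • a) with hZ
    have hph : ∀ a b₁ b₂ : ℤ × ℤ × ℤ,
        LargeSieve.e ((dot3 a b₂ : ℤ) / (e : ℝ)) * LargeSieve.e ((dot3 ((-lam) • a) b₁ : ℤ) / (e : ℝ)) =
          LargeSieve.e ((dot3 a (b₂ - lam • b₁) : ℤ) / (e : ℝ)) := by
      intro a b₁ b₂
      rw [← e_add]; congr 1
      rw [← add_div]; congr 1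
      rw [← Int.cast_add]; congr 1
      simp only [dot3, Prod.smul_fst, Prod.smul_snd, smul_eq_mul, Prod.fst_sub, Prod.snd_sub, neg_mul]
      ring
    have hZexp : ∑ a ∈ resVecs e, Sfrac w₂ C₂ e a * Sfrac w₁ C₁ e ((-lam) • a) =
        ∑ b₁ ∈ C₁, ∑ b₂ ∈ C₂, (w₁ b₁ : ℂ) * (w₂ b₂ : ℂ) *
          ∑ a ∈ resVecs e, LargeSieve.e ((dot3 a (b₂ - lam • b₁) : ℤ) / (e : ℝ)) := by
      calc ∑ a ∈ resVecs e, Sfrac w₂ C₂ e a * Sfrac w₁ C₁ e ((-lam) • a)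
          = ∑ a ∈ resVecs e, ∑ b₂ ∈ C₂, ∑ b₁ ∈ C₁,
              ((w₂ b₂ : ℂ) * LargeSieve.e ((dot3 a b₂ : ℤ) / (e : ℝ))) *
                ((w₁ b₁ : ℂ) * LargeSieve.e ((dot3 ((-lam) • a) b₁ : ℤ) / (e : ℝ))) := by
            refine sum_congr rfl fun a _ => ?_
            simp only [Sfrac]
            rw [sum_mul_sum]
        _ = ∑ b₂ ∈ C₂, ∑ b₁ ∈ C₁, ∑ a ∈ resVecs e,
              ((w₂ b₂ : ℂ) * LargeSieve.e ((dot3 a b₂ : ℤ) / (e : ℝ))) *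
                ((w₁ b₁ : ℂ) * LargeSieve.e ((dot3 ((-lam) • a) b₁ : ℤ) / (e : ℝ))) := by
            rw [Finset.sum_comm]
            refine sum_congr rfl fun b₂ _ => ?_
            rw [Finset.sum_comm]
        _ = ∑ b₁ ∈ C₁, ∑ b₂ ∈ C₂, ∑ a ∈ resVecs e,
              ((w₂ b₂ : ℂ) * LargeSieve.e ((dot3 a b₂ : ℤ) / (e : ℝ))) *
                ((w₁ b₁ : ℂ) * LargeSieve.e ((dot3 ((-lam) • a) b₁ : ℤ) / (e : ℝ))) := Finset.sum_comm
        _ = _ := by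
            refine sum_congr rfl fun b₁ _ => ?_
            refine sum_congr rfl fun b₂ _ => ?_
            rw [mul_sum]
            refine sum_congr rfl fun a _ => ?_
            rw [← hph a b₁ b₂]; ring
    have hcomplex : ((∑ b₁ ∈ C₁, ∑ b₂ ∈ C₂,
        (if DvdVec (e : ℤ) (b₂ - lam • b₁) then w₁ b₁ * w₂ b₂ else 0) : ℝ) : ℂ) = Z / (e : ℂ) ^ 3 := by
      rw [eq_div_iff heC, hZ, hZexp]
      push_cast
      rw [sum_mul]
      refine sum_congr rfl fun b₁ _ => ?_
      rw [sum_mul]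
      refine sum_congr rfl fun b₂ _ => ?_
      rw [sum_resVecs_e_eq he]
      split_ifs <;> push_cast <;> ring
    -- norms
    have hnorm : |∑ b₁ ∈ C₁, ∑ b₂ ∈ C₂, (if DvdVec (e : ℤ) (b₂ - lam • b₁) then w₁ b₁ * w₂ b₂ else 0)| =
        ‖Z‖ / (e : ℝ) ^ 3 := by
      rw [← Real.norm_eq_abs, ← Complex.norm_real, hcomplex, norm_div, norm_pow, Complex.norm_natCast]
    rw [hnorm]
    -- Cauchy–Schwarz
    have hCS : ‖Z‖ ≤ Real.sqrt (Tsum w₂ C₂ e) * Real.sqrt (Tsum w₁ C₁ e) := by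
      calc ‖Z‖ ≤ ∑ a ∈ resVecs e, ‖Sfrac w₂ C₂ e a * Sfrac w₁ C₁ e ((-lam) • a)‖ := norm_sum_le _ _
        _ = ∑ a ∈ resVecs e, ‖Sfrac w₂ C₂ e a‖ * ‖Sfrac w₁ C₁ e ((-lam) • a)‖ := by
            simp_rw [norm_mul]
        _ ≤ Real.sqrt (∑ a ∈ resVecs e, ‖Sfrac w₂ C₂ e a‖ ^ 2) *
              Real.sqrt (∑ a ∈ resVecs e, ‖Sfrac w₁ C₁ e ((-lam) • a)‖ ^ 2) :=
            Real.sum_mul_le_sqrt_mul_sqrt _ _ _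
        _ = Real.sqrt (Tsum w₂ C₂ e) * Real.sqrt (Tsum w₁ C₁ e) := by
            have hμ : Int.gcd (-lam) e = 1 := by rw [Int.neg_gcd]; exact hlam.2
            rw [Tsum_smul_unit he w₁ C₁ hμ]; rfl
    have h1 := Tsum_nonneg w₁ C₁ e
    have h2 := Tsum_nonneg w₂ C₂ e
    have hsq1 := Real.sq_sqrt h1
    have hsq2 := Real.sq_sqrt h2
    have key : 2 * ‖Z‖ ≤ Tsum w₁ C₁ e + Tsum w₂ C₂ e := by
      nlinarith [sq_nonneg (Real.sqrt (Tsum w₂ C₂ e) - Real.sqrt (Tsum w₁ C₁ e)),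
        Real.sqrt_nonneg (Tsum w₁ C₁ e), Real.sqrt_nonneg (Tsum w₂ C₂ e)]
    have he3 : (0 : ℝ) < (e : ℝ) ^ 3 := by positivity
    calc ‖Z‖ / (e : ℝ) ^ 3 = (1 / (2 * (e : ℝ) ^ 3)) * (2 * ‖Z‖) := by field_simp
      _ ≤ (1 / (2 * (e : ℝ) ^ 3)) * (Tsum w₁ C₁ e + Tsum w₂ C₂ e) := by gcongr
      _ = (Tsum w₁ C₁ e + Tsum w₂ C₂ e) / (2 * (e : ℝ) ^ 3) := by ring
  -- Step 3: sum over `Λ`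
  rw [step1]
  calc |∑ lam ∈ unitRes e, ∑ b₁ ∈ C₁, ∑ b₂ ∈ C₂, (if DvdVec (e : ℤ) (b₂ - lam • b₁) then w₁ b₁ * w₂ b₂ else 0)|
      ≤ ∑ lam ∈ unitRes e, |∑ b₁ ∈ C₁, ∑ b₂ ∈ C₂, (if DvdVec (e : ℤ) (b₂ - lam • b₁) then w₁ b₁ * w₂ b₂ else 0)| :=
        abs_sum_le_sum_abs _ _
    _ ≤ ∑ _lam ∈ unitRes e, (Tsum w₁ C₁ e + Tsum w₂ C₂ e) / (2 * (e : ℝ) ^ 3) := sum_le_sum step2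
    _ = #(unitRes e) * ((Tsum w₁ C₁ e + Tsum w₂ C₂ e) / (2 * (e : ℝ) ^ 3)) := by rw [sum_const, nsmul_eq_mul]
    _ ≤ e * ((Tsum w₁ C₁ e + Tsum w₂ C₂ e) / (2 * (e : ℝ) ^ 3)) := by
        have h1 := Tsum_nonneg w₁ C₁ e
        have h2 := Tsum_nonneg w₂ C₂ e
        gcongr
        exact_mod_cast card_unitRes_le e
    _ = (Tsum w₁ C₁ e + Tsum w₂ C₂ e) / (2 * (e : ℝ) ^ 2) := by
        field_simp

end Literature.NumberTheory.Sieve.CubicSieve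

end
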